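import Summits.ResolutionOfSingularities.ResolutionOfSingularities.Theorems.JetCutJetKernels4
import HarnessLib

/-!
# JetCutPoint — decomp-res node «JetCut» (lens-2 g15 rev 5), file 1/2 of `JetCutPoint`

Content VERBATIM from the decomp-res lens-2 file `HOME/decomp-res-lens-2/g15/JetCut.lean` rev 5 (pin 9f53e5ca =
`parts/JetCut-rev5-9f53e5ca.lean`, 7 495 l;
HOME = run/shared/lean/pub/decomp-res; CRITIC-LEDGER rows 109 / 115 / 120 / 121 / 122 / 127 / 133 CLEARED; landing
order INBOX :231; the critic's
HYGIENE-landing.md h1–h11 applied — DOCSTRING-ONLY).  The lens's blocks RESTATED VERBATIM from lens-2 g12 / g13 /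
g14 (§R / §R13 / §R14) are DELETED:
they are the tree's `RelativeDeltaCut*` / `CurveLeafExit*` / `PinchCut*` modules (namespaces `RelativeDeltaCut`,
`CurveLeafExit`, `PinchCut`, opened;
the lens's `CurveLeafExitRestated.x` / `PinchCutRestated.x` are cited as `CurveLeafExit.x` / `PinchCut.x`, the three
pointwise engine edges of g12 as
`RelativeDeltaCut.x`).  Namespace `…Theorems.JetCut` (the lens's `Theses.JetCut` is gate-reserved), sub-namespaces
`Tame` / `Wide` / `Broad` / `Vast`
as in the lens; file split only (tree files ≤ 400 lines): sections, variables and every declaration exactly as in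
the lens, the long rev-0/1 prose
lives in HOME/decomp-res-lens-2/g15/NODE-g15.md §ARCHIVE-A (not in the tree).  Node files, in import order:
`JetCutJetKernels`, `JetCutPoint`, `JetCutClasses`, `JetCutKernels`, `JetCutTame`, `JetCutTameClasses`,
`JetCutTameKernels`, `JetCutLadder`, `JetCutWideClasses`, `JetCutWideKernels`, `JetCutMixed`, `JetCutBroadClasses`,
`JetCutBroadKernels`, `JetCutDegenerate`, `JetCutVastClasses`, `JetCutVastKernels`
(each possibly continued `…2`, `…3`), then the wiring `MaxContactCutJetCut*` (in the Theses cone).  All `--supports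
stmt-ResolutionOfSingularities-29273`
(`MaxContactCut.RungOne`); nothing closes 29273 — decided cells carry their engines as hypotheses, and exactly ONE
located-residual aside is booked on
the route for this column (`Vast.VastSpecialRung`, home `JetCutVastClasses`).

§J2 + §J3 + §J3b + §J3b′ + §J3c: POINT LEVEL — jet-shallow closed points `IsJetShallowAt`, uniformly jet-shallow
curves, ENGINE (J) `JetExit`, the pointwise classes (jet-curve / cone-tail-curve / jet-special points), the
point-level kernels (every cone-curve point is a jet-curve point; (CT) ⊆ (J) at point level modulo the port), and
the LENGTH-TWO LAW (J2): `JetTwoShallow`, `IsJetTwoAt`, ENGINE (J2) `JetTwoExit`, with its ring kernels.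

Part 1/2 carries: `IsJetShallowAt`, `IsUniformJetCurve`, `JetExit`, `IsJetCurvePt`, `IsJetSpecialPt`,
`isJetShallowAt_of_isConeShallowAt`, `isUniformJetCurve_of_isUniformConeCurve`, `isJetCurvePt_of_isConeCurvePt`,
`flatConeExit_of_jetExit`, `IsConeTailShallowAt`, `IsUniformConeTailCurve`, `ConeTailExit`, `IsConeTailCurvePt`,
`isJetShallowAt_of_isConeTailShallowAt`, `isUniformJetCurve_of_isUniformConeTailCurve`,
`isJetCurvePt_of_isConeTailCurvePt`, `not_isJetSpecialPt_of_isConeTailCurvePt`, `coneTailExit_of_jetExit`,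
`chartIdeal`, `ChartRing`, `chartTransform`, `LocallyLE`, `SecondCentre`, `JetTwoShallow`,
`jetTwoShallow_of_jetShallow`, `IsJetTwoShallowAt`, `IsUniformJetTwoCurve`, `JetTwoExit`.

(Sources: HunekeSwanson2006 Cor. 5.5.5; CossartJannsenSaito2020 Ch. 2, Thm. 3.6/3.7, Ch. 8; CossartPiltant2008 Prop.
4.2; CossartPiltant2019 Rem. 3.2; Hironaka1964 Ch. III; Hironaka1967; Hironaka1977; Moh1987; Giraud1975.)
-/

open CategoryTheory AlgebraicGeometry TopologicalSpace IsLocalRing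
open Literature.AlgebraicGeometry.Resolution
open Summit.ResolutionOfSingularities.ResolutionOfSingularities.Theorems
open Summit.ResolutionOfSingularities.ResolutionOfSingularities.Theorems.WeakOrderReduction
open Summit.ResolutionOfSingularities.ResolutionOfSingularities.Theorems.DeltaFaceCutClasses
open Summit.ResolutionOfSingularities.ResolutionOfSingularities.Theorems.RelativeDeltaCut
open Summit.ResolutionOfSingularities.ResolutionOfSingularities.Theorems.CurveLeafExit
open Summit.ResolutionOfSingularities.ResolutionOfSingularities.Theorems.PinchCut

namespace Summit.ResolutionOfSingularities.ResolutionOfSingularities.Theorems.JetCut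

/-! ## §J2  NEW (g15): point level — jet-shallow closed points of a curve, uniformly jet-shallow curves, ENGINE (J) -/

/-- **JET-SHALLOW at `y` transversal to `η`, any `d`** (`IsJetShallowAt I n η y`): regular parameters `c = (z, u₁, …,
u_d)` of `𝒪_{Y,y}` generating the curve prime `curvePrime (η ⤳ y)`, an inert `v` with `(c, v) = 𝔪_y` MINIMAL
(`spanFinrank = d + 2`: the curve is regular at `y` of codimension `d + 1`), `I_y ⊆ (c)ⁿ` (the curve lies in
`Supp(I, n)` near `y`), and `JetShallow 𝔪_y c I_y n`: after the blow-up of the curve NO point over `y` has order `n`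
(EXACT-ON-PAPER, §J1).  No presentation, no preparedness, no class hypothesis: the class-≥-2 closed points of a MIXED curve are
tested like the others.  DEFINITION (NEW class predicate). (Sources: Hironaka1967; CossartJannsenSaito2020 Ch. 2, Ch. 8;
CossartPiltant2008 Prop. 4.2.) -/
def IsJetShallowAt {Y : Scheme.{0}} (I : Y.IdealSheafData) (n : ℕ) (η y : Y) : Prop :=
  ∃ h : η ⤳ y, ∃ (d : ℕ) (c : Fin (d + 1) → Y.presheaf.stalk y) (v : Y.presheaf.stalk y),
    Ideal.span (Set.range c) = curvePrime h ∧
      Ideal.span (Set.range c ∪ {v}) = maximalIdeal (Y.presheaf.stalk y) ∧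
      (maximalIdeal (Y.presheaf.stalk y)).spanFinrank = d + 2 ∧
      stalkIdeal I y ≤ Ideal.span (Set.range c) ^ n ∧
      JetShallow (maximalIdeal (Y.presheaf.stalk y)) c (stalkIdeal I y) n

/-- **UNIFORMLY JET-SHALLOW CURVE** (`IsUniformJetCurve I n η`): `η` is a curve point and EVERY closed point of
`closure {η}` is jet-shallow transversal to `η` (own parameters; same curve prime).  The hypothesis of ENGINE (J).
DEFINITION (NEW class predicate). (Sources: Hironaka1967; CossartJannsenSaito2020 Ch. 2.) -/
def IsUniformJetCurve {Y : Scheme.{0}} (I : Y.IdealSheafData) (n : ℕ) (η : Y) : Prop :=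
  IsCurvePt η ∧ ∀ y : Y, η ⤳ y → IsClosed ({y} : Set Y) → IsJetShallowAt I n η y

/-- **ENGINE (J) `JetExit`** [DECIDED · paper proof in NODE-g15.md §ARCHIVE-A.1 (moved out of the module docstring
in rev 5): (0) `C = closure {η}` is regular (at each
closed point `𝒪_{C,y} = R/(c)` with `(c, v)` minimal; at `η` a field) and `C ⊆ Supp(I, n)` (`I_y ⊆ 𝔭ⁿ`, localise), so
the blow-up `π₁` of `C` is weakly admissible; (1) at a CLOSED point `x'` of `Y₁` over a closed `y ∈ C`, chart `j`:
`𝒪_{Y₁,x'} = (R[X]/chartRel c j)_𝔐` (regular sequence ⇒ blow-up algebra = `R[X]/chartRel`), the controlled transform is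
generated by the `dehomog_j F`, `F(c) ∈ I_y`, and `chartRel + 𝔐ⁿ` is `𝔐`-primary, so `JetShallow` gives
`ord_{x'} I₁ < n`; (2) the locus `{ord I₁ ≥ n} ∩ π₁⁻¹(C)` is closed (port ingredient NAMED as in g14 rev 1: upper
semicontinuity of order on a regular scheme, `𝔭^{(n)} ⊆ 𝔪ⁿ` — Zariski–Nagata, Hironaka 1964 Ch. III §1), `π₁` is proper,
so its image is closed in `C`; a non-empty closed subset of `C` contains a closed point (`IsCurvePt`: every point of `C`
other than `η` is closed, and `{η}` is not closed), over which the fibre — a closed subscheme of `ℙ^d_{κ}` — would have a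
closed point of order `n`, contradicting (1): NO point of order `n` over `C`, the exit clause of `PackageExitsOver` is
vacuous · every regular scheme, every residue field, every `d`, every ideal · port L over `CentreSeq` /
`controlledTransform`]: on a regular scheme, a uniformly jet-shallow curve of order `n ≥ 2` has an exit package with
centres over it (its own blow-up).  By letter (J) CONTAINS g13's (B) `NormalConeJumpExit` and g14's (C) `FlatConeExit`
(one-step engines) and is the TERMINAL one-step engine: «one blow-up of the regular top curve exits» ⟺ uniformly
jet-shallow.  STATEMENT (engine). (Sources: Hironaka1964; Hironaka1967; CossartJannsenSaito2020 Ch. 2, Ch. 8;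
CossartPiltant2008 Prop. 4.2 (a); Huneke1980.) -/
def JetExit : Prop :=
  ∀ (Y : Scheme.{0}), Scheme.IsRegular Y → ∀ (I : Y.IdealSheafData) (n : ℕ), 2 ≤ n →
    ∀ η : Y, IsUniformJetCurve I n η → PackageExitsOver I n {y : Y | η ⤳ y}

/-! ## §J3  NEW (g15): pointwise classes at a top point -/

/-- **JET-CURVE point** (NEW DECIDED CLASS, leaf (J)): `y` lies on (or is the generic point of) a Top-isolated,
uniformly jet-shallow curve `closure {η}`.  DEFINITION (NEW class). (Sources: Hironaka1967; CossartJannsenSaito2020 Ch. 2.) -/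
def IsJetCurvePt {Y : Scheme.{0}} (I : Y.IdealSheafData) (n : ℕ) (y : Y) : Prop :=
  ∃ η : Y, η ⤳ y ∧ IsTopIsolatedClosure I n η ∧ IsUniformJetCurve I n η

/-- **JET-SPECIAL core point** (THE LOCATED CLASS of this node): pinch-special (g14: leaf-special, not pinch-curve, not
cone-curve) and NOT a jet-curve point — on every Top-isolated regular clean curve through `y`, over SOME closed point a
NEAR POINT OF ORDER `n` SURVIVES the blow-up of the curve (or the curve is singular somewhere, or `y` is on no clean
curve).  DEFINITION (NEW class). (Sources: folklore; CossartJannsenSaito2020 Ch. 2 (near points).) -/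
def IsJetSpecialPt {k : Type} [Field k] {Y : Scheme.{0}} (g : Y ⟶ Spec (.of k)) (hY : Scheme.IsRegular Y)
    (I : Y.IdealSheafData) (n : ℕ) (y : Y) : Prop :=
  IsPinchSpecialPt g hY I n y ∧ ¬ IsJetCurvePt I n y

/-! ## §J3b  NEW (g15): point-level KERNELS — every cone-curve point is a jet-curve point; ENGINE (J) ⊒ ENGINE (C) -/

/-- **(C) ⊆ (J) at a closed point**: cone-shallow (g14) ⇒ jet-shallow (g15), marking `n ≥ 1`.  KERNEL (PROVED). [folklore] -/
theorem isJetShallowAt_of_isConeShallowAt {Y : Scheme.{0}} {I : Y.IdealSheafData} {n : ℕ} (hn : n ≠ 0) {η y : Y} :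
    IsConeShallowAt I n η y → IsJetShallowAt I n η y := by
  rintro ⟨h, d, c, v, g, Φ, hc, hcv, hrank, hdeg, hcoef, hg, hf, hle, hC⟩
  refine ⟨h, d, c, v, hc, hcv, hrank, hle, ?_⟩
  have hcoef' : ∀ m ∈ Φ.support, Φ.coeff m ∈ Ideal.span (Set.range c ∪ {v}) := by
    intro m hm
    rw [hcv]
    exact hcoef m hm
  have hC' : ConeShallow (Ideal.span (Set.range c)) v Φ n := by
    rw [hc]
    exact hC
  have key := jetShallow_of_coneShallow hn c v g Φ (stalkIdeal I y) hdeg hcoef' hg hf hC'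
  rwa [hcv] at key

/-- **(C) ⊆ (J) along a curve**: uniformly cone-shallow ⇒ uniformly jet-shallow.  KERNEL (PROVED). [folklore] -/
theorem isUniformJetCurve_of_isUniformConeCurve {Y : Scheme.{0}} {I : Y.IdealSheafData} {n : ℕ} (hn : n ≠ 0)
    {η : Y} : IsUniformConeCurve I n η → IsUniformJetCurve I n η := by
  rintro ⟨hη, hall⟩
  exact ⟨hη, fun y hy hcl => isJetShallowAt_of_isConeShallowAt hn (hall y hy hcl)⟩

/-- **(C) ⊆ (J) as classes**: every cone-curve point (g14 leaf (C)) is a jet-curve point (g15 leaf (J)).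
KERNEL (PROVED) — the subsumption the critic asked to see (cn21 (5)). [folklore] -/
theorem isJetCurvePt_of_isConeCurvePt {Y : Scheme.{0}} {I : Y.IdealSheafData} {n : ℕ} (hn : n ≠ 0) {y : Y} :
    IsConeCurvePt I n y → IsJetCurvePt I n y := by
  rintro ⟨η, hη, htop, hC⟩
  exact ⟨η, hη, htop, isUniformJetCurve_of_isUniformConeCurve hn hC⟩

/-- **ENGINE (J) implies ENGINE (C)**: whoever ports `JetExit` has ported g14's `FlatConeExit`.  KERNEL (PROVED). [folklore] -/
theorem flatConeExit_of_jetExit : JetExit → FlatConeExit := by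
  intro hJ Y hY I n hn η hC
  exact hJ Y hY I n hn η (isUniformJetCurve_of_isUniformConeCurve (by omega) hC)

/-! ## §J3b′  NEW (g15, rev 1): the CONE-TAIL CLASS (CT) at point level and its KERNELS — (CT) ⊆ (J) PROVED at the
point, curve and class level; ENGINE (J) ⊒ ENGINE (CT).  The typed sub-class of g14's located cell that the cone-tail law
decides (cn21 (1) window: «(CT) in kernel carving a decided typed sub-class of `SeqPSpecCurveReg`»): a pinch-special core
point on a Top-isolated, uniformly CONE-TAIL-SHALLOW regular curve (bed: `conetail:2`, `conetail:3a/3b`) is a jet-curve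
point BY KERNEL, hence a curve-exit point under the ONE engine (J) and the ONE port. -/

/-- **CONE-TAIL-SHALLOW at `y` transversal to `η`** [rev 1] (`IsConeTailShallowAt I n η y`): the data `(c, v)` of §J2
(regular parameters `c = (z, u₁, …, u_d)` generating the curve prime, inert `v`, `(c, v) = 𝔪_y` MINIMAL), a NORMALISED
PRESENTATION `c₀ⁿ + v·Ψ(c') + Γ(c') + c₀·w + g ∈ I_y` (`Ψ` and the `γ_i` forms of degree `n` in `U = (U₁, …, U_d)`,
`Γ = Σ U_i γ_i` the first tail layer, `w ∈ (c)ⁿ`, `g ∈ (c)ⁿ⁺²`), `I_y ⊆ (c)ⁿ`, the typed one-step test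
`ConeTailShallow 𝔭 v Ψ γ n` of §J1b (at every point of the exceptional fibre over `y` in a `u_j`-chart: the cone `v̄Ψ̄` is
shallow OR the tail layer `Γ̄` is a unit), and the regularity clause `ExcParamRegular 𝔪_y c v` (`u_j, X₀, v` independent
modulo `𝔪²_{x'}` — AUTOMATIC on a regular scheme with these data [HunekeSwanson2006 Cor. 5.5.5], recorded INSIDE the point
hypothesis exactly as g14 recorded `𝔭`-regularity inside (C); EXACT-ON-PAPER).  Bed: `conetail:2` at the origin with
`c = (z, u₁, u₂)`, `Ψ = (U₁+U₂)²`, `γ = (U₁², 0)`, `w = g = 0`.  Meant for `n ≥ 2`.  DEFINITION (NEW class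
predicate). (Sources: Hironaka1967; CossartJannsenSaito2020 Ch. 2, Ch. 8; CossartPiltant2008 Prop. 4.2;
HunekeSwanson2006 Cor. 5.5.5.) -/
def IsConeTailShallowAt {Y : Scheme.{0}} (I : Y.IdealSheafData) (n : ℕ) (η y : Y) : Prop :=
  ∃ h : η ⤳ y, ∃ (d : ℕ) (c : Fin (d + 1) → Y.presheaf.stalk y) (v w g : Y.presheaf.stalk y)
    (Ψ : MvPolynomial (Fin d) (Y.presheaf.stalk y)) (γ : Fin d → MvPolynomial (Fin d) (Y.presheaf.stalk y)),
    Ideal.span (Set.range c) = curvePrime h ∧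
      Ideal.span (Set.range c ∪ {v}) = maximalIdeal (Y.presheaf.stalk y) ∧
      (maximalIdeal (Y.presheaf.stalk y)).spanFinrank = d + 2 ∧
      (∀ m ∈ Ψ.support, Finsupp.degree m = n) ∧
      (∀ i, ∀ m ∈ (γ i).support, Finsupp.degree m = n) ∧
      w ∈ Ideal.span (Set.range c) ^ n ∧
      g ∈ Ideal.span (Set.range c) ^ (n + 2) ∧
      c 0 ^ n + v * MvPolynomial.eval (fun i : Fin d => c i.succ) Ψ +
          MvPolynomial.eval (fun i : Fin d => c i.succ) (∑ i, MvPolynomial.X i * γ i) + c 0 * w + g ∈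
        stalkIdeal I y ∧
      stalkIdeal I y ≤ Ideal.span (Set.range c) ^ n ∧
      ConeTailShallow (curvePrime h) v Ψ γ n ∧
      ExcParamRegular (maximalIdeal (Y.presheaf.stalk y)) c v

/-- **UNIFORMLY CONE-TAIL-SHALLOW CURVE** [rev 1] (`IsUniformConeTailCurve I n η`): `η` is a curve point and EVERY closed
point of `closure {η}` is cone-tail-shallow (own parameters and presentation, same curve prime).  The hypothesis of
ENGINE (CT).  DEFINITION (NEW class predicate). (Sources: Hironaka1967; CossartJannsenSaito2020 Ch. 2.) -/
def IsUniformConeTailCurve {Y : Scheme.{0}} (I : Y.IdealSheafData) (n : ℕ) (η : Y) : Prop :=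
  IsCurvePt η ∧ ∀ y : Y, η ⤳ y → IsClosed ({y} : Set Y) → IsConeTailShallowAt I n η y

/-- **ENGINE (CT) `ConeTailExit`** [rev 1; DECIDED-BY-(J): `coneTailExit_of_jetExit` · paper proof = the cone-tail law of
the module docstring (c) made a KERNEL in §J1b + the (J) engine]: on a regular scheme, a uniformly cone-tail-shallow
curve of order `n ≥ 2` has an exit package with centres over it (its own blow-up).  STATEMENT (engine). (Sources:
Hironaka1967; CossartJannsenSaito2020 Ch. 2, Ch. 8; CossartPiltant2008 Prop. 4.2 (a).) -/
def ConeTailExit : Prop :=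
  ∀ (Y : Scheme.{0}), Scheme.IsRegular Y → ∀ (I : Y.IdealSheafData) (n : ℕ), 2 ≤ n →
    ∀ η : Y, IsUniformConeTailCurve I n η → PackageExitsOver I n {y : Y | η ⤳ y}

/-- **CONE-TAIL-CURVE point** [rev 1] (NEW TYPED SUB-CLASS of the jet leaf (J)): `y` lies on (or is the generic point of)
a Top-isolated, uniformly cone-tail-shallow curve `closure {η}`.  DEFINITION (NEW class). (Sources: Hironaka1967;
CossartJannsenSaito2020 Ch. 2.) -/
def IsConeTailCurvePt {Y : Scheme.{0}} (I : Y.IdealSheafData) (n : ℕ) (y : Y) : Prop :=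
  ∃ η : Y, η ⤳ y ∧ IsTopIsolatedClosure I n η ∧ IsUniformConeTailCurve I n η

/-- **(CT) ⊆ (J) at a closed point** [rev 1]: cone-tail-shallow ⇒ jet-shallow, marking `n ≥ 2` — the ring-level kernel
`jetShallow_of_coneTailShallow` transported to the stalk.  KERNEL (PROVED). [folklore] -/
theorem isJetShallowAt_of_isConeTailShallowAt {Y : Scheme.{0}} {I : Y.IdealSheafData} {n : ℕ} (hn : 2 ≤ n)
    {η y : Y} : IsConeTailShallowAt I n η y → IsJetShallowAt I n η y := by
  rintro ⟨h, d, c, v, w, g, Ψ, γ, hc, hcv, hrank, hΨdeg, hγdeg, hw, hg, hf, hle, hCT, hreg⟩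
  refine ⟨h, d, c, v, hc, hcv, hrank, hle, ?_⟩
  have hCT' : ConeTailShallow (Ideal.span (Set.range c)) v Ψ γ n := by
    rw [hc]
    exact hCT
  have hreg' : ExcParamRegular (Ideal.span (Set.range c ∪ {v})) c v := by
    rw [hcv]
    exact hreg
  have key := jetShallow_of_coneTailShallow hn c v w g Ψ γ (stalkIdeal I y) hΨdeg hγdeg hw hg hf hCT' hreg'
  rwa [hcv] at key

/-- **(CT) ⊆ (J) along a curve** [rev 1]: uniformly cone-tail-shallow ⇒ uniformly jet-shallow.  KERNEL (PROVED). [folklore] -/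
theorem isUniformJetCurve_of_isUniformConeTailCurve {Y : Scheme.{0}} {I : Y.IdealSheafData} {n : ℕ} (hn : 2 ≤ n)
    {η : Y} : IsUniformConeTailCurve I n η → IsUniformJetCurve I n η := by
  rintro ⟨hη, hall⟩
  exact ⟨hη, fun y hy hcl => isJetShallowAt_of_isConeTailShallowAt hn (hall y hy hcl)⟩

/-- **(CT) ⊆ (J) as classes** [rev 1]: every cone-tail-curve point is a jet-curve point — the typed sub-class of g14's
located cell that the cone-tail law DECIDES (bed `conetail:2/3a/3b`: pinch-special, NOT cone-curve, cone-tail-curve).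
KERNEL (PROVED). [folklore] -/
theorem isJetCurvePt_of_isConeTailCurvePt {Y : Scheme.{0}} {I : Y.IdealSheafData} {n : ℕ} (hn : 2 ≤ n) {y : Y} :
    IsConeTailCurvePt I n y → IsJetCurvePt I n y := by
  rintro ⟨η, hη, htop, hC⟩
  exact ⟨η, hη, htop, isUniformJetCurve_of_isUniformConeTailCurve hn hC⟩

/-- A cone-tail-curve point is never jet-special [rev 1].  KERNEL (PROVED). [folklore] -/
theorem not_isJetSpecialPt_of_isConeTailCurvePt {k : Type} [Field k] {Y : Scheme.{0}} {g : Y ⟶ Spec (.of k)}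
    {hY : Scheme.IsRegular Y} {I : Y.IdealSheafData} {n : ℕ} (hn : 2 ≤ n) {y : Y} (h : IsConeTailCurvePt I n y) :
    ¬ IsJetSpecialPt g hY I n y :=
  fun hs => hs.2 (isJetCurvePt_of_isConeTailCurvePt hn h)

/-- **ENGINE (J) implies ENGINE (CT)** [rev 1]: whoever ports `JetExit` has ported `ConeTailExit`.  KERNEL (PROVED).
[folklore] -/
theorem coneTailExit_of_jetExit : JetExit → ConeTailExit := by
  intro hJ Y hY I n hn η hC
  exact hJ Y hY I n hn η (isUniformJetCurve_of_isUniformConeTailCurve hn hC)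

section JetTwo

variable {R : Type} [CommRing R] {d : ℕ}

/-! ## §J3c  NEW (g15): the LENGTH-TWO LAW — the typed sub-cell of the residual where the «second-order cones» live
(critic row 97 r4 (ii); cn21 (1): «the residual LOCATED beyond the definitional complement, length-2 class TYPED with
its law»)

THE LAW.  At a closed point `y` of the top curve `C` with the data `(c, v)` of §J2, for each chart `j` and each closed
point `x' ↔ 𝔐` of the exceptional fibre: EITHER the jet test (J) passes at `x'` (no near point there) OR `x'` is a near
point at which the NEAR-POINT LOCUS `T₁ = {ord I₁ = n}` is itself a regular curve `Γ = V(c')` inside the exceptional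
divisor, `Γ ⊆ Supp(I₁, n)`, and the transform `I₁` is JET-SHALLOW at `x'` ALONG `Γ` — all said in the chart ring
`S = R[X]/chartIdeal c j ≅ R[c/c_j]` (`chartIdeal` = Koszul relations + the phantom variable, so `S_𝔐 = 𝒪_{Y₁,x'}`
EXACTLY, FACT 1), with «locally at `x'`» expressed saturation-free (`LocallyLE J K 𝔮 :⟺ ∃ s ∉ 𝔮, sJ ⊆ K`) and
«`ord_𝔮 J₁ ≥ n`» as `J₁ ⊆ 𝔮⁽ⁿ⁾` (`LocallyLE J₁ (𝔮ⁿ) 𝔮`; `S_𝔮` is regular).  Clause (4) of `SecondCentre` — every prime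
`𝔮 ⊆ 𝔐̄` of order `≥ n` contains `(c')` — makes the second centre CANONICAL (`Γ` = the near-point locus near `x'`), hence
COHERENT along `C` with no gluing datum: the second centre of the package is the closed set `T₁` itself, which the
local clauses force to be a disjoint union of regular curves over `C`.

ENGINE (J2) `JetTwoExit` [paper proof]: `Y` regular, `n ≥ 2`, `IsUniformJetTwoCurve I n η` ⇒ `PackageExitsOver I n C`
with the package (π₁ = blow-up of `C`; π₂ = blow-up of `T₁ := {x' ∈ π₁⁻¹(C) : ord_{x'} I₁ = n}` with its reduced
structure).  (0)–(1) as for (J): `C` regular, `C ⊆ Supp(I, n)`, `π₁` weakly admissible; `T₁` is closed (semicontinuity,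
port ingredient named as before) and proper over `C`.  (2) At a closed point `x' ∈ T₁` over a closed `y`: the first
disjunct is impossible (it says `ord_{x'} I₁ < n`, FACTS 1–4), so `SecondCentre` holds: by (1)–(2) and `dim 𝒪_{Y₁,x'} =
d + 2` (blow-up of a regular scheme in a regular centre, closed point over closed point) `(c', v')` is a regular system of
parameters, `Γ = V(c')` a regular curve germ; by (3) `Γ ⊆ {ord I₁ ≥ n} = T₁` near `x'` (FACT 4: `I₁ = J₁` locally); by (4)
`T₁ ⊆ Γ` near `x'` (a point of `T₁` specialising to `x'` has a prime `𝔮 ⊆ 𝔐̄` of order `≥ n`); so `T₁ = Γ` near `x'`: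
`T₁` is a regular curve at each of its closed points over closed points of `C`, and by (0) lies in `E₁` over `C`.  Every
component of `T₁` has such a closed point (a component inside a closed fibre trivially; a component dominating `C` is
proper over `C`, so has closed points over closed points), hence `T₁` is a regular curve (disjoint union of components)
inside `Supp(I₁, n)`: `π₂` is weakly admissible with centre over `C`.  (3) After `π₂`: at a closed point `x''` over a
closed `x' ∈ T₁`, clause (5) (`JetShallow 𝔐̄ c' J₁ n` in `S`, read in `𝒪_{Y₂,x''} = (S_𝔐[X']/chartRel c')_{𝔐'}` by
FACTS 1–4 for the regular sequence `c'` of `𝒪_{Y₁,x'}`; an `s ∉ 𝔐̄` is a unit at `x''`) gives `ord_{x''} I₂ < n`; points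
of `Y₁` over `C` off `T₁` have order `< n` and are untouched.  So the order-`n` locus of `I₂` over `C` is a closed set
(semicontinuity on the regular `Y₂`) whose image in `C` (proper) contains no closed point — empty as in (J).  No point of
order `n` over `C`: the exit clause holds vacuously.  ∎  Port ingredients: linear type (twice), semicontinuity of order,
properness, dimension of the blow-up at closed points — the SAME list as (J) plus the dimension count.

BED (desk computation, census-checkable as T-jet2 = «order-n points over the closed point after blowing up C and then
the near-point curve»): `deeptail:2` `z² + v(u₁+u₂)² + u₁⁵` (`p = 2`): ONE near point over each closed point of `C`
(`θ = (1:1)`, chart `u₁`, `h' = z'² + v w² + u₁³`, `w = X₂ + 1`), `T₁ = V(z', u₁, w)` regular, isomorphic to `C`, inside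
`E₁ = {u₁ = 0}`; `c' = (z', u₁, w)`, `v' = v`: clauses (0)–(4) hold (`h' ∈ (c')²`; `{ord h' ≥ 2} = V(z', u₁, w)`), and (5):
`F' = X'₀² + v X'₂² + u₁ X'₁²`, chart `z'`: unit; chart `u₁`: `z''² + v w'² + u₁`, order 1; chart `w`: `z''² + v + u₁w X''₁²`,
order 1 ⇒ `deeptail:2` is JET-TWO-SHALLOW, NOT jet-shallow: it lies in `IsJetTwoCurvePt ∖ IsJetCurvePt`.  CONTROL
(jet-two-special): `deeptail⁺:2` `z² + v(u₁+u₂)² + u₁⁷` (near point `z'² + v w² + u₁⁵`, after the second blow-up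
`z''² + v w'² + u₁³`: order 2 persists) — depth 3.  The DEPTH LADDER `z² + v(u₁+u₂)² + u₁^{2m+1}` (exits after exactly `m`
curve blow-ups) shows the residual of EVERY fixed depth is non-empty: the jet-depth classes are cofinal only as a
sequence — recorded, not claimed. -/

/-- Chart ideal of chart `j`: the Koszul relations `c_i − c_j X_i` AND the phantom variable `X_j` — so that
`R[X] ⧸ chartIdeal c j ≅ R[c/c_j]` is exactly the coordinate ring of chart `j` of the blow-up of `(c)`. -/
noncomputable def chartIdeal {S : Type} [CommRing S] {k : ℕ} (c : Fin k → S) (j : Fin k) :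
    Ideal (MvPolynomial (Fin k) S) :=
  chartRel c j ⊔ Ideal.span {MvPolynomial.X j}

/-- The chart ring `R[c/c_j]` of chart `j` (as a quotient type). -/
abbrev ChartRing {S : Type} [CommRing S] {k : ℕ} (c : Fin k → S) (j : Fin k) : Type :=
  MvPolynomial (Fin k) S ⧸ chartIdeal c j

/-- The chart-`j` CONTROLLED TRANSFORM ideal `J₁ = ⟨dehomog_j F : F homogeneous of degree n, F(c) ∈ J⟩ ⊂ R[c/c_j]`. -/
noncomputable def chartTransform {S : Type} [CommRing S] {k : ℕ} (c : Fin k → S) (j : Fin k) (J : Ideal S) (n : ℕ) :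
    Ideal (ChartRing c j) :=
  Ideal.map (Ideal.Quotient.mk (chartIdeal c j))
    (Ideal.span {G | ∃ F : MvPolynomial (Fin k) S, F.IsHomogeneous n ∧ MvPolynomial.eval c F ∈ J ∧ G = dehomog j F})

/-- `J ⊆ K` LOCALLY AT the prime `𝔮` (`J·S_𝔮 ⊆ K·S_𝔮` for finitely generated `J`): `∃ s ∉ 𝔮, s·J ⊆ K`. -/
def LocallyLE {S : Type} [CommRing S] (J K 𝔮 : Ideal S) : Prop :=
  ∃ s ∉ 𝔮, ∀ g ∈ J, s * g ∈ K

/-- **SECOND CENTRE through the near point `x' ↔ Qb`** of the chart ring `S = R[c/c_j]`, for the transform ideal `J₁`: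
elements `c' = (c'₀, …, c'_d)`, `v'` of `S` with (0) `Γ := V(c')` lies, near `x'`, inside the exceptional divisor
`{e = 0}` (`e = c_j` in chart `j`), hence over `C`; (1) `(c', v') ⊆ 𝔪_{x'}`; (2) `(c', v')` generates `𝔪_{x'}` modulo
`𝔪_{x'}²` (so, `𝒪_{Y₁,x'}` being regular of dimension `d + 2`, `(c', v')` is a regular system of parameters at `x'` and
`Γ := V(c')` is a regular curve germ through `x'`); (3) `J₁ ⊆ (c')ⁿ` locally at `x'` (`Γ ⊆ Supp(I₁, n)`: the second
blow-up, of `Γ`, is weakly admissible); (4) every prime `𝔮 ⊆ 𝔪_{x'}` with `ord_𝔮 J₁ ≥ n` contains `(c')` (the near-point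
locus `T₁ = {ord I₁ = n}` IS `Γ` near `x'` — this makes the second centre CANONICAL, hence coherent along `C`);
(5) the transform `J₁` is JET-SHALLOW at `x'` along `c'` (after blowing up `Γ`, no point over `x'` has order `n`). -/
def SecondCentre {S : Type} [CommRing S] {k : ℕ} (Qb J₁ : Ideal S) (e : S) (n : ℕ) (c' : Fin k → S) (v' : S) :
    Prop :=
  (∃ m : ℕ, LocallyLE (Ideal.span {e ^ m}) (Ideal.span (Set.range c')) Qb) ∧
    Ideal.span (Set.range c' ∪ {v'}) ≤ Qb ∧
    Qb ≤ Ideal.span (Set.range c' ∪ {v'}) ⊔ Qb ^ 2 ∧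
    LocallyLE J₁ (Ideal.span (Set.range c') ^ n) Qb ∧
    (∀ 𝔮 : Ideal S, 𝔮.IsPrime → 𝔮 ≤ Qb → LocallyLE J₁ (𝔮 ^ n) 𝔮 → Ideal.span (Set.range c') ≤ 𝔮) ∧
    JetShallow Qb c' J₁ n

/-- **JET-TWO-SHALLOW = the LENGTH-≤-2 NEAR-POINT TEST along the canonical second centre (EXACT-ON-PAPER)**: at every closed
point `x'` of every chart of the exceptional fibre over the closed point, EITHER `x'` is not a near point (the jet test
(J) passes at `x'`) OR the near-point locus is, near `x'`, a regular curve `Γ = V(c') ⊆ Supp(I₁, n)` along which the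
transform is jet-shallow at `x'`. -/
def JetTwoShallow (M : Ideal R) (c : Fin (d + 1) → R) (J : Ideal R) (n : ℕ) : Prop :=
  ∀ (j : Fin (d + 1)) (Q : Ideal (MvPolynomial (Fin (d + 1)) R)), Q.IsMaximal →
    Ideal.map (MvPolynomial.C : R →+* MvPolynomial (Fin (d + 1)) R) M ≤ Q →
    (MvPolynomial.X j : MvPolynomial (Fin (d + 1)) R) ∈ Q →
      (∃ F : MvPolynomial (Fin (d + 1)) R, F.IsHomogeneous n ∧ MvPolynomial.eval c F ∈ J ∧
          dehomog j F ∉ chartRel c j ⊔ Q ^ n) ∨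
        ∃ (c' : Fin (d + 1) → ChartRing c j) (v' : ChartRing c j),
          SecondCentre (Ideal.map (Ideal.Quotient.mk (chartIdeal c j)) Q) (chartTransform c j J n)
            (Ideal.Quotient.mk (chartIdeal c j) (MvPolynomial.C (c j))) n c' v'

/-- (J) ⊆ (J2) at ring level: jet-shallow ⇒ jet-two-shallow (first disjunct everywhere). [folklore] -/
theorem jetTwoShallow_of_jetShallow {n : ℕ} {M : Ideal R} {c : Fin (d + 1) → R} {J : Ideal R}
    (h : JetShallow M c J n) : JetTwoShallow M c J n :=
  fun j Q hQ hMQ hXj => Or.inl (h j Q hQ hMQ hXj)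

/-- Sanity: the chart ideal kills the phantom variable. -/
example (c : Fin (d + 1) → R) (j : Fin (d + 1)) :
    (Ideal.Quotient.mk (chartIdeal c j) (MvPolynomial.X j) : ChartRing c j) = 0 := by
  rw [Ideal.Quotient.eq_zero_iff_mem, chartIdeal]
  exact Ideal.mem_sup_right (Ideal.subset_span rfl)

/-- Sanity: in the chart ring, `c_i = c_j · (c_i/c_j)`. -/
example (c : Fin (d + 1) → R) (j i : Fin (d + 1)) :
    (Ideal.Quotient.mk (chartIdeal c j) (MvPolynomial.C (c i)) : ChartRing c j) =
      Ideal.Quotient.mk (chartIdeal c j) (MvPolynomial.C (c j) * dehomog j (MvPolynomial.X i)) := by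
  rw [Ideal.Quotient.eq, chartIdeal]
  exact Ideal.mem_sup_left (Ideal.subset_span ⟨i, rfl⟩)

end JetTwo

/-- **JET-TWO-SHALLOW at `y` transversal to `η`** (`IsJetTwoShallowAt I n η y`): the data of `IsJetShallowAt` with the
length-two test `JetTwoShallow` in place of `JetShallow`.  DEFINITION (NEW class predicate: the length-2 law).
(Sources: Hironaka1967; CossartJannsenSaito2020 Ch. 2 (near points), Ch. 8.) -/
def IsJetTwoShallowAt {Y : Scheme.{0}} (I : Y.IdealSheafData) (n : ℕ) (η y : Y) : Prop :=
  ∃ h : η ⤳ y, ∃ (d : ℕ) (c : Fin (d + 1) → Y.presheaf.stalk y) (v : Y.presheaf.stalk y),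
    Ideal.span (Set.range c) = curvePrime h ∧
      Ideal.span (Set.range c ∪ {v}) = maximalIdeal (Y.presheaf.stalk y) ∧
      (maximalIdeal (Y.presheaf.stalk y)).spanFinrank = d + 2 ∧
      stalkIdeal I y ≤ Ideal.span (Set.range c) ^ n ∧
      JetTwoShallow (maximalIdeal (Y.presheaf.stalk y)) c (stalkIdeal I y) n

/-- **UNIFORMLY JET-TWO-SHALLOW CURVE**: `η` is a curve point and every closed point of `closure {η}` is
jet-two-shallow transversal to `η`.  The hypothesis of ENGINE (J2).  DEFINITION (NEW class predicate). (Sources: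
Hironaka1967.) -/
def IsUniformJetTwoCurve {Y : Scheme.{0}} (I : Y.IdealSheafData) (n : ℕ) (η : Y) : Prop :=
  IsCurvePt η ∧ ∀ y : Y, η ⤳ y → IsClosed ({y} : Set Y) → IsJetTwoShallowAt I n η y

/-- **ENGINE (J2) `JetTwoExit`** [paper proof in the §J3c docstring: package (blow-up of `C`; blow-up of the near-point
locus `T₁`, a regular curve over `C` by clauses (0)–(4)); exit by clause (5); port ingredients: linear type ×2,
semicontinuity of order, properness, dimension of the blow-up · every regular scheme, every residue field, every `d`,
every ideal · port L]: on a regular scheme, a uniformly jet-two-shallow curve of order `n ≥ 2` has an exit package (of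
length two) with centres over it.  STATEMENT (engine). (Sources: Hironaka1967; CossartJannsenSaito2020 Ch. 2, Ch. 8;
HunekeSwanson2006 Cor. 5.5.5.) -/
def JetTwoExit : Prop :=
  ∀ (Y : Scheme.{0}), Scheme.IsRegular Y → ∀ (I : Y.IdealSheafData) (n : ℕ), 2 ≤ n →
    ∀ η : Y, IsUniformJetTwoCurve I n η → PackageExitsOver I n {y : Y | η ⤳ y}

end Summit.ResolutionOfSingularities.ResolutionOfSingularities.Theorems.JetCut
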